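import Summits.HodgeConjecture.CorCM.OcticDecicWeil22HodgeOfMarkman
import Summits.HodgeConjecture.CorCM.SexticOcticWeilHodgeOfMarkman
import HarnessLib

/-!
# MULTI-FIELD WEIL ENGINE — THE MARKMAN WEIL SPACES, INTRINSIC: the `hW m` inputs of the generic headlines for the four slot kinds Markman's theorems cover,
# stated WITHOUT frames (only the degree of the field and the `k`-signature of the type), plus one dispatcher

Cell `pub-hodgecm2` (COR-CM), seat b30 gen 30 (2026-08-24); count-neutral own lane MULTI-FIELD WEIL ENGINE (stem `MultiFieldWeil*`), companion of the INTRINSIC headlines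
of `CorCM/MultiFieldWeilPrimes.lean` / `CorCM/MultiFieldWeilEqualPrimes.lean` / `CorCM/MultiFieldWeilCoprimeOneMember.lean` (whose `hW m` hypotheses mention no frame).
Theorems only; no definition, no named fact of its own, no `sorry`.  HONEST FRAMING: each supplier is CONDITIONAL on the displayed named fact — Markman's FOURFOLD theorem
`Markman2025_weilClasses_algebraic_abelianFourfold` or his HYPERBOLIC-SIXFOLD theorem `Markman2025_weilClasses_algebraic_hyperbolicSixfold`; every other single-slot Weil
space (`B_m × E^{n_m − 2p_m}` of dimension `≥ 8`, or a sixfold not of the two shapes below) is OPEN.  `HC_CM` is NOT proved and not asserted.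

The frames the gen-28/29 suppliers want (type read at position `0`, or at `{0, 1}`) are produced here from the intrinsic data by the normal-form frame lemmas already in
the tree (`SexticOcticWeil.exists_frame_fin`, `OcticWeilFourfold.exists_frame₂`, `SexticDecicWeil.exists_frame_fin₂`); the conclusions never mentioned the frame.
* **`weilHyp_of_markman_fourfold_intrinsic`** — `[K_m : ℚ] = 6`, ONE member over `τ`: `(n, p, c, w) = (3, 1, 1, 2)`, the Weil plane of `B_m ⊞ E` (Markman fourfold);
* **`weilHyp_of_markman_sixfold_octic_intrinsic`** — `[K_m : ℚ] = 8`, ONE member: `(4, 1, 2, 3)`, `B_m ⊞ E ⊞ E` (Markman hyperbolic sixfold);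
* **`weilHyp_of_markman_fourfold22_intrinsic`** — `[K_m : ℚ] = 8`, TWO members: `(4, 2, 0, 2)`, `B_m` itself, an abelian fourfold of Weil type (Markman fourfold);
* **`weilHyp_of_markman_sixfold_decic_intrinsic`** — `[K_m : ℚ] = 10`, TWO members: `(5, 2, 1, 3)`, `B_m ⊞ E` (Markman hyperbolic sixfold);
* **`weilHyp_of_markman_intrinsic`** — the dispatcher on `(n_m, p_m) ∈ {(3,1), (4,1), (4,2), (5,2)}` at general exponents `c = n_m − 2p_m`, `w = n_m − p_m`.
[cite: Markman2025SurveySecant, Thm. 1.2] [cite: Markman2025SecantWeil, Thm 1.5.1] [cite: vanGeemen1994HodgeAV, 4.9–4.10] [cite: Deligne1982HodgeCycles, §5 (c)]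
[cite: MoonenZarhin1995Duke, Thm. 2.4]

## References
* [Markman2025SurveySecant] E. Markman, arXiv:2509.23403, Thm. 1.2.  [Markman2025SecantWeil] E. Markman, Cycles on abelian 2n-folds of Weil type from secant sheaves on
  abelian n-folds, Thm 1.5.1.  [vanGeemen1994HodgeAV] B. van Geemen, in: Algebraic Cycles and Hodge Theory (LNM 1594), 4.9–4.10.  [Deligne1982HodgeCycles] P. Deligne,
  Hodge cycles on abelian varieties (LNM 900), §5 (c).  [MoonenZarhin1995Duke] B. Moonen, Yu. Zarhin, Duke Math. J. 77 (1995), Thm. 2.4.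
-/

noncomputable section

open CategoryTheory CategoryTheory.Limits NumberField

namespace Summit.HodgeConjecture.CorCM.MultiFieldWeil

open Literature.AlgebraicGeometry Literature.AlgebraicGeometry.Motives Literature.AlgebraicGeometry.HodgeTheory
open Literature.AlgebraicGeometry.ComplexMultiplication (IsCMTypeRealisation)
open Literature.AlgebraicTopology.SingularHomology
open Literature.NumberTheory.ComplexMultiplication
open Summit.HodgeConjecture.CorCM.SexticOcticWeil (exists_frame_fin card_filter_comp_eq_of_finrank)
open Summit.HodgeConjecture.CorCM.SexticDecicWeil (exists_frame_fin₂)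
open Summit.HodgeConjecture.CorCM.OcticWeilFourfold (exists_frame₂)
open Summit.HodgeConjecture.CorCM.OcticDecicWeil22 (inr_mem_phi₂_iff_snd_eq_decide)

open scoped Classical

variable {I : Type} {r : ℕ} {Kf : I → Type} [∀ i, Field (Kf i)] [∀ i, NumberField (Kf i)] [∀ i, IsCMField (Kf i)]
  {i₀ : I} {is : Fin r → I} {τ : Kf i₀ →+* ℂ} {im : ∀ m : Fin r, Kf i₀ →+* Kf (is m)}
  {A : Fin (r + 1) → AbelianVariety ℂ} {Φ : ∀ j : Fin (r + 1), CMType (Kf (mfSlots i₀ is j))}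
  {ι : ∀ j, 𝓞 (Kf (mfSlots i₀ is j)) →+* End (A j)}
  {θ : ∀ j, Kf (mfSlots i₀ is j) →+* Module.End ℂ (complexBetti (A j).X 1)}
  {δ : 𝓞 (Kf i₀)} {d : ℕ}

/-! ## §1 The four intrinsic suppliers -/

/-- **SEXTIC, ONE member over `τ`** (`(n, p) = (3, 1)`; `c = 1`, `w = 2`): the Weil plane of `B_m ⊞ E`, from Markman's FOURFOLD theorem — no frame in the statement.
[cite: Markman2025SurveySecant, Thm. 1.2] [cite: vanGeemen1994HodgeAV, 4.9–4.10] -/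
theorem weilHyp_of_markman_fourfold_intrinsic (hW4 : Markman2025_weilClasses_algebraic_abelianFourfold) (m : Fin r)
    (h6 : Module.finrank ℚ (Kf (is m)) = 6) (h2 : Module.finrank ℚ (Kf i₀) = 2) (hd : 0 < d) (hδ : ((δ : Kf i₀)) ^ 2 = -(d : Kf i₀))
    (hA : ∀ j, IsCMTypeRealisation (Φ j) (A j) (ι j) (θ j)) (hΨ : ∀ σ : Kf i₀ →+* ℂ, σ ∈ (Φ 0).1 ↔ σ = τ)
    (h1 : (Finset.univ.filter fun s : Kf (is m) →+* ℂ => s.comp (im m) = τ ∧ s ∈ (Φ m.succ).1).card = 1) :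
    weilClassesOf (⨁ fun i => A (partSlots 1 m i)) (biproduct.map fun i => ι (partSlots 1 m i) (δfam im δ (partSlots 1 m i))) 2 d ≤
      algebraicClasses (⨁ fun i => A (partSlots 1 m i)).X 2 := by
  have hττ : ComplexEmbedding.conjugate τ ≠ τ := QuarticCM.conjugate_ne τ
  have hk : ∀ σ : Kf i₀ →+* ℂ, σ = τ ∨ σ = ComplexEmbedding.conjugate τ := fun σ => QuarticCM.eq_or_eq_conjugate_of_quadratic h2 τ σ
  obtain ⟨e₁, he_sign, -, hΦm⟩ := exists_frame_fin (n := 2) (im m) hττ hk (card_filter_comp_eq_of_finrank (n := 3) (im m) h6 h2 τ) (Φ m.succ) h1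
  exact weilHyp_of_markman_fourfold hW4 m h6 h2 hd hδ hA e₁ he_sign hΦm hΨ

/-- **OCTIC, ONE member over `τ`** (`(n, p) = (4, 1)`; `c = 2`, `w = 3`): the Weil plane of `B_m ⊞ E ⊞ E`, from Markman's HYPERBOLIC-SIXFOLD theorem — no frame.
[cite: Markman2025SecantWeil, Thm 1.5.1] [cite: Deligne1982HodgeCycles, §5 (c)] -/
theorem weilHyp_of_markman_sixfold_octic_intrinsic (hM6 : Markman2025_weilClasses_algebraic_hyperbolicSixfold) (m : Fin r)
    (h8 : Module.finrank ℚ (Kf (is m)) = 8) (h2 : Module.finrank ℚ (Kf i₀) = 2) (hd : 0 < d) (hδ : ((δ : Kf i₀)) ^ 2 = -(d : Kf i₀))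
    (hA : ∀ j, IsCMTypeRealisation (Φ j) (A j) (ι j) (θ j)) (hΨ : ∀ σ : Kf i₀ →+* ℂ, σ ∈ (Φ 0).1 ↔ σ = τ)
    (h1 : (Finset.univ.filter fun s : Kf (is m) →+* ℂ => s.comp (im m) = τ ∧ s ∈ (Φ m.succ).1).card = 1) :
    weilClassesOf (⨁ fun i => A (partSlots 2 m i)) (biproduct.map fun i => ι (partSlots 2 m i) (δfam im δ (partSlots 2 m i))) 3 d ≤
      algebraicClasses (⨁ fun i => A (partSlots 2 m i)).X 3 := by
  have hττ : ComplexEmbedding.conjugate τ ≠ τ := QuarticCM.conjugate_ne τ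
  have hk : ∀ σ : Kf i₀ →+* ℂ, σ = τ ∨ σ = ComplexEmbedding.conjugate τ := fun σ => QuarticCM.eq_or_eq_conjugate_of_quadratic h2 τ σ
  obtain ⟨e₂, he_sign, -, hΦm⟩ := exists_frame_fin (n := 3) (im m) hττ hk (card_filter_comp_eq_of_finrank (n := 4) (im m) h8 h2 τ) (Φ m.succ) h1
  exact weilHyp_of_markman_sixfold_octic hM6 m h8 h2 hd hδ hA e₂ he_sign hΦm hΨ

/-- **OCTIC, TWO members over `τ`** (`(n, p) = (4, 2)`; `c = 0`, `w = 2`): `B_m` itself is an abelian fourfold of Weil type for `k`; its Weil plane from Markman's FOURFOLD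
theorem — no frame. [cite: Markman2025SurveySecant, Thm. 1.2] [cite: MoonenZarhin1995Duke, Thm. 2.4] -/
theorem weilHyp_of_markman_fourfold22_intrinsic (hW4 : Markman2025_weilClasses_algebraic_abelianFourfold) (m : Fin r)
    (h8 : Module.finrank ℚ (Kf (is m)) = 8) (h2 : Module.finrank ℚ (Kf i₀) = 2) (hd : 0 < d) (hδ : ((δ : Kf i₀)) ^ 2 = -(d : Kf i₀))
    (hA : ∀ j, IsCMTypeRealisation (Φ j) (A j) (ι j) (θ j))
    (h22 : (Finset.univ.filter fun s : Kf (is m) →+* ℂ => s.comp (im m) = τ ∧ s ∈ (Φ m.succ).1).card = 2) :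
    weilClassesOf (⨁ fun i => A (partSlots 0 m i)) (biproduct.map fun i => ι (partSlots 0 m i) (δfam im δ (partSlots 0 m i))) 2 d ≤
      algebraicClasses (⨁ fun i => A (partSlots 0 m i)).X 2 := by
  have hττ : ComplexEmbedding.conjugate τ ≠ τ := QuarticCM.conjugate_ne τ
  have hk : ∀ σ : Kf i₀ →+* ℂ, σ = τ ∨ σ = ComplexEmbedding.conjugate τ := fun σ => QuarticCM.eq_or_eq_conjugate_of_quadratic h2 τ σ
  obtain ⟨e₂, he_sign, -, hΦ'⟩ := exists_frame₂ h8 h2 (im m) hττ hk (Φ m.succ) h22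
  have hΦm : ∀ s : Kf (is m) →+* ℂ, s ∈ (Φ m.succ).1 ↔ (e₂ s).2 = decide ((e₂ s).1 = 0 ∨ (e₂ s).1 = 1) := fun s =>
    (hΦ' s).trans (inr_mem_phi₂_iff_snd_eq_decide (e₂ s))
  exact weilHyp_of_markman_fourfold22 hW4 m h8 h2 hd hδ hA e₂ he_sign hΦm

/-- **DECIC, TWO members over `τ`** (`(n, p) = (5, 2)`; `c = 1`, `w = 3`): the Weil plane of `B_m ⊞ E`, from Markman's HYPERBOLIC-SIXFOLD theorem — no frame.
[cite: Markman2025SecantWeil, Thm 1.5.1] [cite: vanGeemen1994HodgeAV, 4.9–4.10] -/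
theorem weilHyp_of_markman_sixfold_decic_intrinsic (hM6 : Markman2025_weilClasses_algebraic_hyperbolicSixfold) (m : Fin r)
    (h10 : Module.finrank ℚ (Kf (is m)) = 10) (h2 : Module.finrank ℚ (Kf i₀) = 2) (hd : 0 < d) (hδ : ((δ : Kf i₀)) ^ 2 = -(d : Kf i₀))
    (hA : ∀ j, IsCMTypeRealisation (Φ j) (A j) (ι j) (θ j)) (hΨ : ∀ σ : Kf i₀ →+* ℂ, σ ∈ (Φ 0).1 ↔ σ = τ)
    (h23 : (Finset.univ.filter fun s : Kf (is m) →+* ℂ => s.comp (im m) = τ ∧ s ∈ (Φ m.succ).1).card = 2) :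
    weilClassesOf (⨁ fun i => A (partSlots 1 m i)) (biproduct.map fun i => ι (partSlots 1 m i) (δfam im δ (partSlots 1 m i))) 3 d ≤
      algebraicClasses (⨁ fun i => A (partSlots 1 m i)).X 3 := by
  have hττ : ComplexEmbedding.conjugate τ ≠ τ := QuarticCM.conjugate_ne τ
  have hk : ∀ σ : Kf i₀ →+* ℂ, σ = τ ∨ σ = ComplexEmbedding.conjugate τ := fun σ => QuarticCM.eq_or_eq_conjugate_of_quadratic h2 τ σ
  obtain ⟨e₃, he_sign, -, hΦm⟩ := exists_frame_fin₂ h10 h2 (im m) hττ hk (Φ m.succ) h23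
  exact weilHyp_of_markman_sixfold_decic hM6 m h10 h2 hd hδ hA e₃ he_sign hΦm hΨ

/-! ## §2 The dispatcher -/

/-- **THE MARKMAN DISPATCHER.**  For a slot `m` whose field has degree `2 n_m` and whose type has `p_m` members over `τ`, with
`(n_m, p_m) ∈ {(3,1), (4,1), (4,2), (5,2)}`: the Weil space of the single-slot part `B_m ⊞ E^{n_m − 2p_m}` in degree `2(n_m − p_m)` is algebraic, from Markman's fourfold
and hyperbolic-sixfold theorems — exactly the `hW m` input of the intrinsic headlines at `c = n_m − 2p_m`, `w = n_m − p_m`.  Every other `(n_m, p_m)` is OPEN.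
[cite: Markman2025SurveySecant, Thm. 1.2] [cite: Markman2025SecantWeil, Thm 1.5.1] -/
theorem weilHyp_of_markman_intrinsic (hW4 : Markman2025_weilClasses_algebraic_abelianFourfold) (hM6 : Markman2025_weilClasses_algebraic_hyperbolicSixfold)
    (m : Fin r) {nm pm : ℕ} (hnp : (nm = 3 ∧ pm = 1) ∨ (nm = 4 ∧ pm = 1) ∨ (nm = 4 ∧ pm = 2) ∨ (nm = 5 ∧ pm = 2))
    (hdeg : Module.finrank ℚ (Kf (is m)) = 2 * nm) (h2 : Module.finrank ℚ (Kf i₀) = 2) (hd : 0 < d) (hδ : ((δ : Kf i₀)) ^ 2 = -(d : Kf i₀))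
    (hA : ∀ j, IsCMTypeRealisation (Φ j) (A j) (ι j) (θ j)) (hΨ : ∀ σ : Kf i₀ →+* ℂ, σ ∈ (Φ 0).1 ↔ σ = τ)
    (hp : (Finset.univ.filter fun s : Kf (is m) →+* ℂ => s.comp (im m) = τ ∧ s ∈ (Φ m.succ).1).card = pm) :
    weilClassesOf (⨁ fun i => A (partSlots (nm - 2 * pm) m i)) (biproduct.map fun i => ι (partSlots (nm - 2 * pm) m i) (δfam im δ (partSlots (nm - 2 * pm) m i)))
      (nm - pm) d ≤ algebraicClasses (⨁ fun i => A (partSlots (nm - 2 * pm) m i)).X (nm - pm) := by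
  rcases hnp with ⟨rfl, rfl⟩ | ⟨rfl, rfl⟩ | ⟨rfl, rfl⟩ | ⟨rfl, rfl⟩
  · exact weilHyp_of_markman_fourfold_intrinsic hW4 m hdeg h2 hd hδ hA hΨ hp
  · exact weilHyp_of_markman_sixfold_octic_intrinsic hM6 m hdeg h2 hd hδ hA hΨ hp
  · exact weilHyp_of_markman_fourfold22_intrinsic hW4 m hdeg h2 hd hδ hA hp
  · exact weilHyp_of_markman_sixfold_decic_intrinsic hM6 m hdeg h2 hd hδ hA hΨ hp

end Summit.HodgeConjecture.CorCM.MultiFieldWeil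

end
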